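import Mathlib
import Literature.MathematicalPhysics.QuantumFieldTheory.SUNBakryEmeryPoincare
import Literature.MathematicalPhysics.QuantumFieldTheory.Luscher2010.FlowActionSeriesProofs
import Summits.Ventures.LatticeQCDFlow.TrivializingMaps.SlotCasimir

/-!
# Single-link slot coefficient functions and the tree's invariant derivatives (E7 of THEORY-1 §19, part 1)

HONEST FRAMING. Exact (Metropolis-corrected) sampling algorithms for lattice gauge theory; figures of
merit are autocorrelation/cost numbers at stated couplings and volumes; no continuum-physics claim.
This file is matrix calculus; no physics, no measure theory.

For a slot system `(lnk, pol)` (`SlotRepresentation`) and a link `e`: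

1. `sum_slotGen_frame_mul_self` : `∑_α Y_α^{σ,e} Y_α^{σ,e} = -2 C^{σ,e}` for the tree's Parseval frame
   `Y_α` of `𝔰𝔲(n)` (`SUNBakryEmery.frame`) and the slot Casimir `C^{σ,e} = -∑ₐ T_a^{σ,e} T_a^{σ,e}`
   (`SlotCasimir.casimirM`, basis normalised by `tr T_aT_b = -½δ_{ab}`) — the basis/frame exchange of
   `Luscher2010.SuBasis.sum_mul_self`.
2. `slotFnC`, `slotFn` : the single-link coefficient functions `g ↦ (Re) ∑ a_{IJ} R_σ(W[e ↦ g])_{IJ}` with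
   kernel `a : Ker σ n`; they are smooth (`contDiff_slotFn`), and the tree's invariant derivative
   `SUNBakryEmery.matD A` (curves `g e^{tA}`) acts on them by contracting the kernel with the generator
   `A^{σ,e}` placed to the RIGHT of `R_σ` (`matD_slotFn`, via `SlotRepresentation.slotRep_mul`); hence the
   Laplace–Beltrami operator `SUNBakryEmery.Lap = ∑_α D_α D_α` acts through `-2 C^{σ,e}`:
   `Lap_slotFn : Δ_tree u[a] = -2 · u[a ⋆ C^{σ,e}]`, and on the eigen-kernels `rowKer I x` of an
   eigenvector `C^{σ,e} x = λ x` it acts by the scalar `-2λ` (`Lap_slotFn_of_eigen`).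

Part 2 (`SlotCasimirGap`) feeds these into the tree's Poincaré inequality on `SU(n)`.
[folklore (matrix calculus); ours: the kernel bookkeeping `contractR`]
-/

noncomputable section

namespace Summit.Ventures.LatticeQCDFlow.TrivializingMaps.SlotFunctions

open scoped ComplexConjugate Matrix Matrix.Norms.Frobenius ContDiff
open Finset
open Literature.MathematicalPhysics.QuantumFieldTheory
open Literature.MathematicalPhysics.QuantumFieldTheory.Luscher2010
open Literature.MathematicalPhysics.QuantumFieldTheory.SUNBakryEmery
open SlotRepresentation SlotCasimir


variable {n : ℕ} {σ : Type*} [Fintype σ] [DecidableEq σ] {E : Type*} [DecidableEq E]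

/-! ## 1. The slot Casimir in the tree's Parseval frame -/

section Frame
variable (B : SuBasis n) (lnk : σ → E) (pol : σ → Bool)

/-- `∑_α Y_α^{σ,e} Y_α^{σ,e} = -2 C^{σ,e}`: exchange of the basis `T_a` (`tr T_aT_b = -½δ`) for the tree's
Parseval frame `Y_α` of `𝔰𝔲(n)`, through the `ℝ`-linearity of `Y ↦ Y^{σ,e}`. [folklore] -/
theorem sum_slotGen_frame_mul_self (hn : n ≠ 0) (e : E) :
    ∑ α, slotGen lnk pol e (frame α) * slotGen lnk pol e (frame α) = (-2 : ℂ) • casimirM B lnk pol e := by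
  have hmem : ∀ a, (B.T a)ᴴ = -B.T a ∧ (B.T a).trace = 0 := fun a => (mem_suAlgebra_iff _).1 (B.mem a)
  have h1 : ∀ a, B.T a = ∑ α, (-(frame α * B.T a).trace.re) • frame α :=
    fun a => (sum_re_trace_smul_frame hn (hmem a).1 (hmem a).2).symm
  have h2 : ∀ α, frame (N := n) α ∈ suAlgebra n := fun α =>
    (mem_suAlgebra_iff _).2 ⟨frame_conjTranspose α, frame_trace hn α⟩
  have h3 : ∀ a, slotGen lnk pol e (B.T a) =
      ∑ α, ((-(frame α * B.T a).trace.re : ℝ) : ℂ) • slotGen lnk pol e (frame α) := fun a => by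
    conv_lhs => rw [h1 a]
    exact slotGen_sum_smul lnk pol e _ _ _
  have h4 : ∀ α, ∑ a, ((-(frame α * B.T a).trace.re : ℝ) : ℂ) • slotGen lnk pol e (B.T a) =
      (1 / 2 : ℂ) • slotGen lnk pol e (frame α) := fun α => by
    rw [← slotGen_sum_smul lnk pol e, B.sum_re_trace_smul (h2 α)]
    have h := slotGen_smul_real lnk pol e (1 / 2 : ℝ) (frame (N := n) α)
    rw [← Complex.coe_smul] at h
    push_cast at h
    exact h
  have key : ∑ a, slotGen lnk pol e (B.T a) * slotGen lnk pol e (B.T a) =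
      (1 / 2 : ℂ) • ∑ α, slotGen lnk pol e (frame α) * slotGen lnk pol e (frame α) := by
    calc ∑ a, slotGen lnk pol e (B.T a) * slotGen lnk pol e (B.T a)
        = ∑ a, slotGen lnk pol e (B.T a) *
            ∑ α, ((-(frame α * B.T a).trace.re : ℝ) : ℂ) • slotGen lnk pol e (frame α) :=
          sum_congr rfl fun a _ => by rw [← h3 a]
      _ = ∑ α, (∑ a, ((-(frame α * B.T a).trace.re : ℝ) : ℂ) • slotGen lnk pol e (B.T a)) *
            slotGen lnk pol e (frame α) := by
          simp_rw [Finset.mul_sum, Matrix.mul_smul, Finset.sum_mul, Matrix.smul_mul]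
          rw [Finset.sum_comm]
      _ = ∑ α, ((1 / 2 : ℂ) • slotGen lnk pol e (frame α)) * slotGen lnk pol e (frame α) :=
          sum_congr rfl fun α _ => by rw [h4 α]
      _ = (1 / 2 : ℂ) • ∑ α, slotGen lnk pol e (frame α) * slotGen lnk pol e (frame α) := by
          rw [Finset.smul_sum]
          simp_rw [Matrix.smul_mul]
  have h22 : (-2 : ℂ) * (1 / 2) = -1 := by norm_num
  rw [casimirM, key, smul_neg, smul_smul, h22, neg_smul, one_smul, neg_neg]

end Frame

/-! ## 2. Single-link coefficient functions and the tree's invariant derivatives -/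

section Calculus
variable (lnk : σ → E) (pol : σ → Bool)

/-- Kernels `a_{IJ}` on slot multi-indices. [folklore] -/
abbrev Ker (σ : Type*) (n : ℕ) : Type _ := (σ → Fin n) → (σ → Fin n) → ℂ

/-- Right contraction of a kernel with a matrix: `(a ⋆ᵣ G)_{IK} = ∑_J a_{IJ} G_{KJ}`, so that
`∑ a_{IJ} (R G)_{IJ} = ∑ (a ⋆ᵣ G)_{IK} R_{IK}`. [folklore] -/
def contractR (a : Ker σ n) (G : Matrix (σ → Fin n) (σ → Fin n) ℂ) : Ker σ n :=
  fun I K => ∑ J, a I J * G K J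

/-- `∑_{I,J} a_{IJ} (R G)_{IJ} = ∑_{I,K} (a ⋆ᵣ G)_{IK} R_{IK}`. [folklore] -/
theorem sum_mul_mul_eq_contractR (a : Ker σ n) (R G : Matrix (σ → Fin n) (σ → Fin n) ℂ) :
    ∑ I, ∑ J, a I J * (R * G) I J = ∑ I, ∑ K, contractR a G I K * R I K := by
  refine sum_congr rfl fun I _ => ?_
  simp only [contractR, Matrix.mul_apply, Finset.mul_sum, Finset.sum_mul]
  rw [Finset.sum_comm]
  exact sum_congr rfl fun K _ => sum_congr rfl fun J _ => by ring

/-- Iterated right contraction: `(a ⋆ᵣ G) ⋆ᵣ G' = a ⋆ᵣ (G' G)`. [folklore] -/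
theorem contractR_contractR (a : Ker σ n) (G G' : Matrix (σ → Fin n) (σ → Fin n) ℂ) :
    contractR (contractR a G) G' = contractR a (G' * G) := by
  funext I K
  simp only [contractR, Matrix.mul_apply, Finset.mul_sum, Finset.sum_mul]
  rw [Finset.sum_comm]
  exact sum_congr rfl fun J' _ => sum_congr rfl fun J _ => by ring

/-- Right contraction is additive in the matrix. [folklore] -/
theorem contractR_sum {κ : Type*} (s : Finset κ) (a : Ker σ n)
    (G : κ → Matrix (σ → Fin n) (σ → Fin n) ℂ) :
    contractR a (∑ k ∈ s, G k) = fun I K => ∑ k ∈ s, contractR a (G k) I K := by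
  funext I K
  simp only [contractR, Matrix.sum_apply, Finset.mul_sum]
  rw [Finset.sum_comm]

/-- Right contraction with a scalar multiple. [folklore] -/
theorem contractR_smul (a : Ker σ n) (c : ℂ) (G : Matrix (σ → Fin n) (σ → Fin n) ℂ) :
    contractR a (c • G) = fun I K => c * contractR a G I K := by
  funext I K
  simp only [contractR, Matrix.smul_apply, smul_eq_mul, Finset.mul_sum]
  exact sum_congr rfl fun J _ => by ring

/-- Right contraction of a scaled kernel. [folklore] -/
theorem contractR_smul_ker (c : ℂ) (a : Ker σ n) (G : Matrix (σ → Fin n) (σ → Fin n) ℂ) :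
    contractR (fun I J => c * a I J) G = fun I K => c * contractR a G I K := by
  funext I K
  simp only [contractR, Finset.mul_sum, mul_assoc]

/-- The **single-link coefficient function** (complex form) `g ↦ ∑_{I,J} a_{IJ} R_σ(W[e ↦ g])_{IJ}` of a
kernel `a`, a base configuration `W` and a link `e`, as a function on all of `M_n(ℂ)`. [ours] -/
def slotFnC (a : Ker σ n) (W : E → Matrix (Fin n) (Fin n) ℂ) (e : E) (g : Matrix (Fin n) (Fin n) ℂ) : ℂ :=
  ∑ I, ∑ J, a I J * slotRep lnk pol (Function.update W e g) I J

/-- The real single-link coefficient function `Re slotFnC`. [ours] -/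
def slotFn (a : Ker σ n) (W : E → Matrix (Fin n) (Fin n) ℂ) (e : E) : Matrix (Fin n) (Fin n) ℂ → ℝ :=
  fun g => (slotFnC lnk pol a W e g).re

/-- `slotFnC` of a scaled kernel. [folklore] -/
theorem slotFnC_smul_ker (c : ℂ) (a : Ker σ n) (W : E → Matrix (Fin n) (Fin n) ℂ) (e : E)
    (g : Matrix (Fin n) (Fin n) ℂ) :
    slotFnC lnk pol (fun I J => c * a I J) W e g = c * slotFnC lnk pol a W e g := by
  simp only [slotFnC, Finset.mul_sum, mul_assoc]

/-- `slotFnC` is additive in the kernel. [folklore] -/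
theorem slotFnC_sum_ker {κ : Type*} (s : Finset κ) (b : κ → Ker σ n) (W : E → Matrix (Fin n) (Fin n) ℂ)
    (e : E) (g : Matrix (Fin n) (Fin n) ℂ) :
    ∑ k ∈ s, slotFnC lnk pol (b k) W e g = slotFnC lnk pol (fun I J => ∑ k ∈ s, b k I J) W e g := by
  simp only [slotFnC, Finset.sum_mul]
  rw [Finset.sum_comm]
  refine sum_congr rfl fun I _ => ?_
  rw [Finset.sum_comm]

/-- `slotFnC (a ⋆ᵣ G)` is `∑ a_{IJ} (R_σ G)_{IJ}`. [folklore] -/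
theorem slotFnC_contractR (a : Ker σ n) (G : Matrix (σ → Fin n) (σ → Fin n) ℂ)
    (W : E → Matrix (Fin n) (Fin n) ℂ) (e : E) (g : Matrix (Fin n) (Fin n) ℂ) :
    slotFnC lnk pol (contractR a G) W e g =
      ∑ I, ∑ J, a I J * (slotRep lnk pol (Function.update W e g) * G) I J := by
  rw [sum_mul_mul_eq_contractR]; rfl

/-! ### Smoothness -/

omit [DecidableEq σ] [DecidableEq E] in
/-- Matrix elements of the slot representation are smooth functions of the configuration. [folklore] -/
theorem contDiff_slotRep_apply [Fintype E] (I J : σ → Fin n) :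
    ContDiff ℝ ∞ fun W : E → Matrix (Fin n) (Fin n) ℂ => slotRep lnk pol W I J := by
  have hentry : ∀ s, ContDiff ℝ ∞ fun W : E → Matrix (Fin n) (Fin n) ℂ => W (lnk s) (I s) (J s) :=
    fun s => (WilsonFlow.entryCLM (I s) (J s)).contDiff.comp
      (contDiff_apply ℝ (Matrix (Fin n) (Fin n) ℂ) (lnk s))
  have hfac : ∀ s, ContDiff ℝ ∞ fun W : E → Matrix (Fin n) (Fin n) ℂ =>
      polM (pol s) (W (lnk s)) (I s) (J s) := by
    intro s
    cases pol s
    · have h := Complex.conjCLE.contDiff.comp (hentry s)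
      simpa only [polM_false, Matrix.map_apply, Function.comp_def, Complex.conjCLE_apply] using h
    · simpa only [polM_true] using hentry s
  simp only [slotRep, kronPi_apply]
  exact contDiff_prod fun s _ => hfac s

/-- Updating one link is a smooth (affine) map of the link value. [folklore] -/
theorem contDiff_update [Fintype E] (W : E → Matrix (Fin n) (Fin n) ℂ) (e : E) :
    ContDiff ℝ ∞ fun g : Matrix (Fin n) (Fin n) ℂ => Function.update W e g := by
  refine contDiff_pi.2 fun e' => ?_
  by_cases h : e' = e
  · subst h
    have hid : (fun g : Matrix (Fin n) (Fin n) ℂ => Function.update W e' g e') = id :=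
      funext fun g => Function.update_self e' g W
    rw [hid]
    exact contDiff_id
  · simpa only [Function.update_of_ne h] using
      (contDiff_const : ContDiff ℝ ∞ fun _ : Matrix (Fin n) (Fin n) ℂ => W e')

/-- Single-link coefficient functions are smooth (complex form). [folklore] -/
theorem contDiff_slotFnC [Fintype E] (a : Ker σ n) (W : E → Matrix (Fin n) (Fin n) ℂ) (e : E) :
    ContDiff ℝ ∞ (slotFnC lnk pol a W e) := by
  unfold slotFnC
  exact ContDiff.sum fun I _ => ContDiff.sum fun J _ =>
    contDiff_const.mul ((contDiff_slotRep_apply lnk pol I J).comp (contDiff_update W e))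

/-- Single-link coefficient functions are smooth. [folklore] -/
theorem contDiff_slotFn [Fintype E] (a : Ker σ n) (W : E → Matrix (Fin n) (Fin n) ℂ) (e : E) :
    ContDiff ℝ ∞ (slotFn lnk pol a W e) :=
  Complex.reCLM.contDiff.comp (contDiff_slotFnC lnk pol a W e)

/-! ### Right-invariant derivatives: generators to the right of `R_σ` -/

/-- `W[e ↦ gX] = W[e ↦ g] · 1[e ↦ X]` (pointwise product of configurations). [folklore] -/
theorem update_mul_eq (W : E → Matrix (Fin n) (Fin n) ℂ) (e : E) (g X : Matrix (Fin n) (Fin n) ℂ) :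
    Function.update W e (g * X) = fun e' => Function.update W e g e' *
      Function.update (fun _ => (1 : Matrix (Fin n) (Fin n) ℂ)) e X e' := by
  funext e'
  by_cases h : e' = e
  · subst h; simp only [Function.update_self]
  · simp only [Function.update_of_ne h, mul_one]

/-- `d/dt R_σ(1[e ↦ e^{tA}])|₀ = A^{σ,e}` (entrywise). [folklore] -/
theorem hasDerivAt_slotRep_one_update (e : E) (A : Matrix (Fin n) (Fin n) ℂ) (K J : σ → Fin n) :
    HasDerivAt (fun t : ℝ => slotRep lnk pol
        (Function.update (fun _ => (1 : Matrix (Fin n) (Fin n) ℂ)) e (NormedSpace.exp (t • A))) K J)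
      (slotGen lnk pol e A K J) 0 := by
  have h := hasDerivAt_slotRep_apply lnk pol (fun _ => (1 : Matrix (Fin n) (Fin n) ℂ)) e A K J
  simp only [mul_one, slotRep_one] at h
  simpa only [Matrix.mul_one] using h

/-- **Right derivative of a coefficient function**: `d/dt u[a](g e^{tA})|₀ = u[a ⋆ᵣ A^{σ,e}](g)` — the
generator appears to the right of `R_σ` (`R_σ` is multiplicative in the configuration). [folklore] -/
theorem hasDerivAt_slotFnC_right (a : Ker σ n) (W : E → Matrix (Fin n) (Fin n) ℂ) (e : E)
    (g A : Matrix (Fin n) (Fin n) ℂ) :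
    HasDerivAt (fun t : ℝ => slotFnC lnk pol a W e (g * NormedSpace.exp (t • A)))
      (slotFnC lnk pol (contractR a (slotGen lnk pol e A)) W e g) 0 := by
  have hfun : (fun t : ℝ => slotFnC lnk pol a W e (g * NormedSpace.exp (t • A))) = fun t : ℝ =>
      ∑ I, ∑ J, a I J * ∑ K, slotRep lnk pol (Function.update W e g) I K *
        slotRep lnk pol (Function.update (fun _ => (1 : Matrix (Fin n) (Fin n) ℂ)) e
          (NormedSpace.exp (t • A))) K J := by
    funext t
    simp only [slotFnC, update_mul_eq W e g, slotRep_mul, Matrix.mul_apply]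
  have hval : slotFnC lnk pol (contractR a (slotGen lnk pol e A)) W e g =
      ∑ I, ∑ J, a I J * ∑ K, slotRep lnk pol (Function.update W e g) I K * slotGen lnk pol e A K J := by
    rw [slotFnC_contractR]
    simp only [Matrix.mul_apply]
  rw [hfun, hval]
  have hIJ : ∀ I J : σ → Fin n, HasDerivAt (fun t : ℝ => a I J * ∑ K, slotRep lnk pol (Function.update W e g) I K *
      slotRep lnk pol (Function.update (fun _ => (1 : Matrix (Fin n) (Fin n) ℂ)) e
        (NormedSpace.exp (t • A))) K J)
      (a I J * ∑ K, slotRep lnk pol (Function.update W e g) I K * slotGen lnk pol e A K J) 0 :=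
    fun I J => (HasDerivAt.fun_sum fun K _ =>
      (hasDerivAt_slotRep_one_update lnk pol e A K J).const_mul
        (slotRep lnk pol (Function.update W e g) I K)).const_mul (a I J)
  have hI : ∀ I : σ → Fin n, HasDerivAt (fun t : ℝ => ∑ J, a I J * ∑ K, slotRep lnk pol (Function.update W e g) I K *
      slotRep lnk pol (Function.update (fun _ => (1 : Matrix (Fin n) (Fin n) ℂ)) e
        (NormedSpace.exp (t • A))) K J)
      (∑ J, a I J * ∑ K, slotRep lnk pol (Function.update W e g) I K * slotGen lnk pol e A K J) 0 :=
    fun I => HasDerivAt.fun_sum fun J _ => hIJ I J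
  exact HasDerivAt.fun_sum fun I _ => hI I

/-- Real part of a differentiable complex curve. [folklore] -/
theorem hasDerivAt_re {f : ℝ → ℂ} {f' : ℂ} {x : ℝ} (hf : HasDerivAt f f' x) :
    HasDerivAt (fun t => (f t).re) f'.re x :=
  Complex.reCLM.hasFDerivAt.comp_hasDerivAt x hf

/-- **The tree's invariant derivative of a coefficient function**:
`D_A u[a] = u[a ⋆ᵣ A^{σ,e}]` (`SUNBakryEmery.matD`, curves `g e^{tA}`). [folklore] -/
theorem matD_slotFn [Fintype E] (a : Ker σ n) (W : E → Matrix (Fin n) (Fin n) ℂ) (e : E)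
    (A g : Matrix (Fin n) (Fin n) ℂ) :
    matD A (slotFn lnk pol a W e) g = slotFn lnk pol (contractR a (slotGen lnk pol e A)) W e g := by
  have h1 := hasDerivAt_comp_mul_exp (contDiff_slotFn lnk pol a W e) g A 0
  have h2 : HasDerivAt (fun s : ℝ => slotFn lnk pol a W e (g * NormedSpace.exp (s • A)))
      (slotFn lnk pol (contractR a (slotGen lnk pol e A)) W e g) 0 :=
    hasDerivAt_re (hasDerivAt_slotFnC_right lnk pol a W e g A)
  have h := h1.unique h2
  simpa only [zero_smul, NormedSpace.exp_zero, mul_one] using h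

variable (B : SuBasis n)

/-- **The tree's Laplace–Beltrami operator on a coefficient function acts through the slot Casimir**:
`Δ_tree u[a] = -2 · u[a ⋆ᵣ C^{σ,e}]` (`SUNBakryEmery.Lap = ∑_α D_α D_α`, frame form of `C^{σ,e}`). [ours] -/
theorem Lap_slotFn [Fintype E] (hn : n ≠ 0) (a : Ker σ n) (W : E → Matrix (Fin n) (Fin n) ℂ) (e : E)
    (g : Matrix (Fin n) (Fin n) ℂ) :
    Lap (slotFn lnk pol a W e) g = -2 * slotFn lnk pol (contractR a (casimirM B lnk pol e)) W e g := by
  have h1 : ∀ α, matD (frame α) (matD (frame α) (slotFn lnk pol a W e)) g =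
      slotFn lnk pol (contractR a (slotGen lnk pol e (frame α) * slotGen lnk pol e (frame α))) W e g := by
    intro α
    have hf : matD (frame α) (slotFn lnk pol a W e) =
        slotFn lnk pol (contractR a (slotGen lnk pol e (frame α))) W e :=
      funext fun g' => matD_slotFn lnk pol a W e (frame α) g'
    rw [hf, matD_slotFn, contractR_contractR]
  simp only [Lap, h1, slotFn]
  rw [← Complex.re_sum, slotFnC_sum_ker, ← contractR_sum, sum_slotGen_frame_mul_self B lnk pol hn e,
    contractR_smul, slotFnC_smul_ker]
  have h2 : ((-2 : ℂ) * slotFnC lnk pol (contractR a (casimirM B lnk pol e)) W e g).re =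
      -2 * (slotFnC lnk pol (contractR a (casimirM B lnk pol e)) W e g).re := by
    rw [show (-2 : ℂ) = ((-2 : ℝ) : ℂ) by push_cast; ring, Complex.re_ofReal_mul]
  exact h2

/-! ### Eigen-kernels -/

/-- The row kernel of a vector: `u[rowKer I₀ x] = (R_σ x)_{I₀}`. [ours] -/
def rowKer (I₀ : σ → Fin n) (x : (σ → Fin n) → ℂ) : Ker σ n := fun I J => if I = I₀ then x J else 0

/-- `slotFnC (rowKer I₀ x) = (R_σ(W[e ↦ g]) x)_{I₀}`. [ours] -/
theorem slotFnC_rowKer (I₀ : σ → Fin n) (x : (σ → Fin n) → ℂ) (W : E → Matrix (Fin n) (Fin n) ℂ)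
    (e : E) (g : Matrix (Fin n) (Fin n) ℂ) :
    slotFnC lnk pol (rowKer I₀ x) W e g = (slotRep lnk pol (Function.update W e g) *ᵥ x) I₀ := by
  simp only [slotFnC, rowKer, ite_mul, zero_mul]
  rw [Finset.sum_comm]
  simp only [Finset.sum_ite_eq', Finset.mem_univ, if_true, Matrix.mulVec, dotProduct]
  exact sum_congr rfl fun J _ => mul_comm _ _

/-- `slotFnC (c · rowKer I₀ x) = c (R_σ(W[e ↦ g]) x)_{I₀}`. [ours] -/
theorem slotFnC_smul_rowKer (c : ℂ) (I₀ : σ → Fin n) (x : (σ → Fin n) → ℂ)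
    (W : E → Matrix (Fin n) (Fin n) ℂ) (e : E) (g : Matrix (Fin n) (Fin n) ℂ) :
    slotFnC lnk pol (fun I J => c * rowKer I₀ x I J) W e g =
      c * (slotRep lnk pol (Function.update W e g) *ᵥ x) I₀ := by
  rw [← slotFnC_rowKer lnk pol I₀ x W e g]
  exact slotFnC_smul_ker lnk pol c (rowKer I₀ x) W e g

/-- `rowKer I₀ x ⋆ᵣ M = rowKer I₀ (M x)`. [ours] -/
theorem contractR_rowKer (I₀ : σ → Fin n) (x : (σ → Fin n) → ℂ) (M : Matrix (σ → Fin n) (σ → Fin n) ℂ) :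
    contractR (rowKer I₀ x) M = rowKer I₀ (M *ᵥ x) := by
  funext I K
  by_cases h : I = I₀
  · simp only [contractR, rowKer, h, if_true, Matrix.mulVec, dotProduct]
    exact sum_congr rfl fun J _ => mul_comm _ _
  · simp only [contractR, rowKer, h, if_false, zero_mul, Finset.sum_const_zero]

/-- An eigen-kernel of `C^{σ,e}` gives an eigenfunction of `Δ_tree`: `Δ_tree u[a] = -2λ u[a]`. [ours] -/
theorem Lap_slotFn_of_eigen [Fintype E] (hn : n ≠ 0) {e : E} {a : Ker σ n} {ev : ℝ}
    (ha : contractR a (casimirM B lnk pol e) = fun I K => (ev : ℂ) * a I K)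
    (W : E → Matrix (Fin n) (Fin n) ℂ) (g : Matrix (Fin n) (Fin n) ℂ) :
    Lap (slotFn lnk pol a W e) g = (-2 * ev) * slotFn lnk pol a W e g := by
  rw [Lap_slotFn lnk pol B hn, ha, slotFn, slotFn, slotFnC_smul_ker, Complex.re_ofReal_mul, mul_assoc]

end Calculus

end Summit.Ventures.LatticeQCDFlow.TrivializingMaps.SlotFunctions
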